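import Mathlib.Analysis.Normed.Module.DoubleDual
import Summits.QuantumFields.YangMills.Theorems.BalabanUVNodesK0Stub1PairingsAtExtensions
import HarnessLib

/-!
# K0⁷ STUB 1 (`stub_prop8StepCoP13`), sub-target S4b «the (δ∕δA′)V pieces at objects» — **THE `θ₀` SOCKET**: the (73)ᵀ column letter `h73t` of the S4b capstone ∕ Socket
# (`K0Stub1SectFWSlotAtRecordSocket.exists_sectF_W_atRecord_of_chartSocket`, p621022) for ANY transposed derivative `Dt` (`BE (Dt A′ X) δ = B X (𝔇 A′ δ)`) FROM
# (157)-SHAPED KERNEL ENTRIES OF `𝔇` — `‖𝔇 A′ (δ_b·a) t‖ ≤ Θ·κ(t,b)·‖a‖` — AND A WEIGHTED COLUMN SUM `w₃(b)·Σ_t κ(t,b)∕wB′(t) ≤ K`: then `w₃(b)‖Dt A′ X b‖ ≤ |c|⁻¹M_ρΘK·s`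
# whenever `wB′(t)‖X t‖ ≤ s` — generic fibre (tracial contractive `τ` with dualiser `ρ`, `‖ρℓ‖ ≤ M_ρ‖ℓ‖`), generic pairing constant `c` (`η^d` at the record), NO chart named

Cell `pub-ymgap`, width seat `pub-ymgap-k0-s1-w2` g4 (CLAIM-5; the τ-adjoint∕fibre half of `θ₀` that dag-n07-w2 g4's LOCATED-THETA0 (bus 2026-08-28 09:33Z) assigns to this seat).
`--kind proof --supports stmt-QuantumFields-20541 --as helper`; count-neutral; def-free.  [15] = [Balaban1985Variational]; [B7] = [Balaban1985Averaging].

WHY.  After p621022 the S4b W-slot at the record displays, besides the chart `Dfun` itself, the numbers `q₀ θ₀ h₀` (+`q`); k0-s1-w4's FILES 5–8 supply `q₀ q h₀` for the straight∕♭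
average and the rescaled flat right inverse.  `θ₀` — `(∀ i, wB′ i‖X i‖ ≤ s) → ∀ b, w₃ b‖Dt A′ X b‖ ≤ θ₀·r·s` for the transpose `Dt A′` of `𝔇 A′ = fderiv Dfun A′` — splits into
(i) a per-bond KERNEL ENTRY bound for `𝔇 A′` in the chart of record ((73) with decay read per fine bond: dag-n07-w2's `…N07ChartDDecayRefBond` v1.1 for the single-bar chart,
`Θ = 4C₃ε·e^{2δ}`, `κ(t,b) = w₁(b)e^{−δ·d(b,t)}`; [B7] Prop. 5 (157) for the double-bar chart, `κ(t,b) = η·L^{j(t)}L^{−j(t)d}·𝟙[t reads b]`-type), (ii) a weighted COLUMN SUM of `κ`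
(lattice geometry of the chart lane ∕ port), and (iii) the τ-ADJOINT bookkeeping turning (i)+(ii) into the letter for ANY `Dt` satisfying the transposition identity — THIS FILE is
(iii), once and for all: testing `hDt` against `δ := δ_b·ρℓ′` gives `c·ℓ′((Dt A′ X)_b) = Σ_t τ(X_t·𝔇 A′(δ_b·ρℓ′)_t)` (tracial `τ`, dualiser `ρ`), the entries and `‖ρℓ′‖ ≤ M_ρ‖ℓ′‖`
bound every functional of `(Dt A′ X)_b`, and Mathlib's `NormedSpace.norm_le_dual_bound` (Hahn–Banach) bounds its norm.  LOCATED (evidence #51, p619371, p621832): with the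
single-bar entries (i) the column sum (ii) is `≍ L^{4(K−n)}` at the top level (sup-derived `κ = w₁(b)e^{−δd}`) and `≍ L^{3(K−n)}` even for the sharp kernel (base-point modes);
with the (157)♭ entries it is k-uniform — this file is neutral to that ruling.

WHAT IS PROVED (sorry-free; no definition; axioms standard; finite index types `ι` (fine bonds) and `κ` (index bonds), any normed ℂ-algebra fibre `𝔸`).
* §1 ★★ `norm_adjoint_apply_le_of_kernelEntries` — tracial contractive `τ`, dualiser `ρ` with `‖ρℓ‖ ≤ M_ρ‖ℓ‖`, `BE Y δ = c·Σ_b τ(Y_b δ_b)` (`c ≠ 0`), `B X X′ = Σ_t τ(X_t X′_t)`, a linear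
  map `𝔇₀ : (ι → 𝔸) →ₗ (κ → 𝔸)` with entries `‖𝔇₀(δ_b·a) t‖ ≤ Θ·κ(t,b)·‖a‖` (`κ ≥ 0`, `Θ ≥ 0`), ANY map `T` with `BE (T X) δ = B X (𝔇₀ δ)`:
  `‖T X b‖ ≤ ‖c‖⁻¹·M_ρ·Θ·Σ_t κ(t,b)·‖X t‖`.
* §1 ★★ `weighted_column_letter_of_kernelEntries` — plus weights `w₃ ≥ 0` on `ι`, `wB′ > 0` on `κ`, a column sum `w₃(b)·Σ_t κ(t,b)·(wB′ t)⁻¹ ≤ K`: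
  `(∀ t, wB′ t·‖X t‖ ≤ s) → ∀ b, w₃ b·‖T X b‖ ≤ (‖c‖⁻¹·M_ρ·Θ·K)·s`.
* §2 ★★★ `h73t_of_kernelEntries` — the capstone∕Socket binder `h73t` VERBATIM at the (27) pairing `BE = bondPair η d τ` of the record (`c = η^d`; `ι = PBond P 0`, `κ = BondIdx D`),
  for ANY `Dt` with `∀ A′ X δ, BE (Dt A′ X) δ = B X (fderiv ℂ Dfun A′ δ)`, from the displayed per-point entry family
  `hentry : sizes(A′) ≤ r < ε ⇒ ‖fderiv ℂ Dfun A′ (δ_b·a) t‖ ≤ Θ·r·κ(t,b)·‖a‖` and the column sum `hcol`: `θ₀ := (|η|^d)⁻¹·M_ρ·Θ·K`.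
HONEST SCOPE.  Finite-dimensional duality bookkeeping; NO estimate on any chart; the entry family (i) and the column sum (ii) are DISPLAYED (chart lane ∕ port); nothing of [15]∕[B7]
asserted; `stub_prop8StepCoP13` ∕ K0⁷ NOT closed; N07 NOT discharged; counts unmoved (28∕28 · 5∕27); one finite 𝕋⁴ programme at fixed ε — R4 closes the conditional finite-𝕋⁴ rung
`BalabanLadder.UV` only, never the summit; the YM mass gap (Clay) is NOT proved by any of this; nothing continuum ∕ ℝ⁴ ∕ OS.  No `sorry`, no `def`, no `instance`, no `notation`.

References: [15] (27) p.282, (66) p.287, (72)–(73) p.289, (87)–(90) pp.291–292, Prop. 4 (97)–(98) pp.292–293; [B7] Prop. 5 (157) pp.40–42.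
-/

set_option autoImplicit false

noncomputable section

open scoped BigOperators

namespace Summit.QuantumFields.YangMills.Theorems.K0Stub1DtColumnSocket

open Literature.MathematicalPhysics.QuantumFieldTheory.Balaban1983to89
open B6SectADomainsV1 (Domains)
open B6SectAOperatorsV1 (BondIdx)
open B9Eq39Adjoint (bondPair)
open Summit.QuantumFields.YangMills.Theorems.K0Stub1PairingsAtExtensions (bondPair_PBond_eq_sum)

/-! ## §1  Generic fibre: the adjoint of a map with (157)-shaped kernel entries, bounded through the dual -/

section Fibre

variable {ι κ 𝔸 : Type*} [Fintype ι] [Fintype κ] [DecidableEq ι] [NormedRing 𝔸] [NormedAlgebra ℂ 𝔸]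

/-- ★★ **THE ADJOINT OF A KERNEL WITH ENTRY BOUNDS, THROUGH THE DUAL.**  For a tracial contractive `τ` with dualiser `ρ` (`τ(ρℓ·X) = ℓX`, `‖ρℓ‖ ≤ M_ρ‖ℓ‖`), the pairings
`BE Y δ = c·Σ_b τ(Y_b δ_b)` (`c ≠ 0`) and `B X X′ = Σ_t τ(X_t X′_t)`, an additive map `𝔇₀` with per-bond entries `‖𝔇₀(δ_b·a) t‖ ≤ Θ·κ(t,b)·‖a‖`, and ANY `T` with
`BE (T X) δ = B X (𝔇₀ δ)`: `‖T X b‖ ≤ ‖c‖⁻¹·M_ρ·Θ·Σ_t κ(t,b)‖X t‖`. [cite: Balaban1985Variational, (27) p.282, (66) p.287, (73) p.289, (88)-(90) pp.291-292] -/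
theorem norm_adjoint_apply_le_of_kernelEntries (τ : 𝔸 →L[ℂ] ℂ) (ρ : (𝔸 →L[ℂ] ℂ) →L[ℂ] 𝔸)
    (hρ : ∀ (ℓ' : 𝔸 →L[ℂ] ℂ) (X : 𝔸), τ (ρ ℓ' * X) = ℓ' X) (hτ : ∀ a b : 𝔸, τ (a * b) = τ (b * a)) (hτ1 : ∀ X : 𝔸, ‖τ X‖ ≤ ‖X‖)
    {Mρ : ℝ} (hMρ : 0 ≤ Mρ) (hρn : ∀ ℓ' : 𝔸 →L[ℂ] ℂ, ‖ρ ℓ'‖ ≤ Mρ * ‖ℓ'‖)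
    {c : ℂ} (hc : c ≠ 0)
    {BE : (ι → 𝔸) → (ι → 𝔸) → ℂ} (hBE : ∀ Y δ, BE Y δ = c * ∑ b, τ (Y b * δ b))
    {B : (κ → 𝔸) → (κ → 𝔸) → ℂ} (hB : ∀ X X', B X X' = ∑ t, τ (X t * X' t))
    (𝔇₀ : (ι → 𝔸) →ₗ[ℂ] (κ → 𝔸)) (kap : κ → ι → ℝ) (hk0 : ∀ t b, 0 ≤ kap t b) {Θ : ℝ} (hΘ : 0 ≤ Θ)
    (hentry : ∀ (b : ι) (a : 𝔸) (t : κ), ‖𝔇₀ (Pi.single b a) t‖ ≤ Θ * kap t b * ‖a‖)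
    {T : (κ → 𝔸) → (ι → 𝔸)} (hT : ∀ X δ, BE (T X) δ = B X (𝔇₀ δ)) (X : κ → 𝔸) (b : ι) :
    ‖T X b‖ ≤ ‖c‖⁻¹ * Mρ * Θ * ∑ t, kap t b * ‖X t‖ := by
  have hsum0 : 0 ≤ ∑ t, kap t b * ‖X t‖ := Finset.sum_nonneg fun t _ => mul_nonneg (hk0 t b) (norm_nonneg _)
  refine NormedSpace.norm_le_dual_bound ℂ (T X b) (by positivity) fun ℓ' => ?_
  -- test the transposition identity against `δ := δ_b · ρℓ′`
  have key := hT X (Pi.single b (ρ ℓ'))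
  rw [hBE, hB, Finset.sum_eq_single b (fun b' _ hb' => by rw [Pi.single_eq_of_ne hb', mul_zero, map_zero])
    (fun h => absurd (Finset.mem_univ _) h), Pi.single_eq_same, hτ, hρ] at key
  -- `ℓ′(T X b) = c⁻¹ · Σ_t τ(X_t · 𝔇₀(δ_b ρℓ′)_t)`
  have h1 : ℓ' (T X b) = c⁻¹ * ∑ t, τ (X t * 𝔇₀ (Pi.single b (ρ ℓ')) t) := by
    rw [← key, ← mul_assoc, inv_mul_cancel₀ hc, one_mul]
  rw [h1, norm_mul, norm_inv]
  have h2 : ‖∑ t, τ (X t * 𝔇₀ (Pi.single b (ρ ℓ')) t)‖ ≤ ∑ t, kap t b * ‖X t‖ * (Θ * (Mρ * ‖ℓ'‖)) := by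
    refine (norm_sum_le _ _).trans (Finset.sum_le_sum fun t _ => ?_)
    calc ‖τ (X t * 𝔇₀ (Pi.single b (ρ ℓ')) t)‖ ≤ ‖X t * 𝔇₀ (Pi.single b (ρ ℓ')) t‖ := hτ1 _
      _ ≤ ‖X t‖ * ‖𝔇₀ (Pi.single b (ρ ℓ')) t‖ := norm_mul_le _ _
      _ ≤ ‖X t‖ * (Θ * kap t b * ‖ρ ℓ'‖) := mul_le_mul_of_nonneg_left (hentry b (ρ ℓ') t) (norm_nonneg _)
      _ ≤ ‖X t‖ * (Θ * kap t b * (Mρ * ‖ℓ'‖)) :=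
          mul_le_mul_of_nonneg_left (mul_le_mul_of_nonneg_left (hρn ℓ') (mul_nonneg hΘ (hk0 t b))) (norm_nonneg _)
      _ = kap t b * ‖X t‖ * (Θ * (Mρ * ‖ℓ'‖)) := by ring
  calc ‖c‖⁻¹ * ‖∑ t, τ (X t * 𝔇₀ (Pi.single b (ρ ℓ')) t)‖
      ≤ ‖c‖⁻¹ * (∑ t, kap t b * ‖X t‖ * (Θ * (Mρ * ‖ℓ'‖))) := mul_le_mul_of_nonneg_left h2 (inv_nonneg.2 (norm_nonneg _))
    _ = ‖c‖⁻¹ * Mρ * Θ * (∑ t, kap t b * ‖X t‖) * ‖ℓ'‖ := by rw [← Finset.sum_mul]; ring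

/-- ★★ **THE WEIGHTED COLUMN LETTER FROM KERNEL ENTRIES AND A COLUMN SUM** — §1's bound under weights: `w₃ ≥ 0` on fine bonds, `wB′ > 0` on index bonds (`κ` non-empty, so that `s ≥ 0`), and the column sum
`w₃(b)·Σ_t κ(t,b)·(wB′ t)⁻¹ ≤ K`: `(∀ t, wB′ t‖X t‖ ≤ s) → ∀ b, w₃ b‖T X b‖ ≤ (‖c‖⁻¹M_ρΘK)·s`. [cite: Balaban1985Variational, (73) p.289, (88)-(90) pp.291-292, (98) p.293] -/
theorem weighted_column_letter_of_kernelEntries (τ : 𝔸 →L[ℂ] ℂ) (ρ : (𝔸 →L[ℂ] ℂ) →L[ℂ] 𝔸)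
    (hρ : ∀ (ℓ' : 𝔸 →L[ℂ] ℂ) (X : 𝔸), τ (ρ ℓ' * X) = ℓ' X) (hτ : ∀ a b : 𝔸, τ (a * b) = τ (b * a)) (hτ1 : ∀ X : 𝔸, ‖τ X‖ ≤ ‖X‖)
    {Mρ : ℝ} (hMρ : 0 ≤ Mρ) (hρn : ∀ ℓ' : 𝔸 →L[ℂ] ℂ, ‖ρ ℓ'‖ ≤ Mρ * ‖ℓ'‖)
    {c : ℂ} (hc : c ≠ 0)
    {BE : (ι → 𝔸) → (ι → 𝔸) → ℂ} (hBE : ∀ Y δ, BE Y δ = c * ∑ b, τ (Y b * δ b))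
    {B : (κ → 𝔸) → (κ → 𝔸) → ℂ} (hB : ∀ X X', B X X' = ∑ t, τ (X t * X' t))
    (𝔇₀ : (ι → 𝔸) →ₗ[ℂ] (κ → 𝔸)) (kap : κ → ι → ℝ) (hk0 : ∀ t b, 0 ≤ kap t b) {Θ : ℝ} (hΘ : 0 ≤ Θ)
    (hentry : ∀ (b : ι) (a : 𝔸) (t : κ), ‖𝔇₀ (Pi.single b a) t‖ ≤ Θ * kap t b * ‖a‖)
    {T : (κ → 𝔸) → (ι → 𝔸)} (hT : ∀ X δ, BE (T X) δ = B X (𝔇₀ δ))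
    [Nonempty κ] (w₃ : ι → ℝ) (hw₃ : ∀ b, 0 ≤ w₃ b) (wB' : κ → ℝ) (hwB' : ∀ t, 0 < wB' t) {K : ℝ}
    (hcol : ∀ b, w₃ b * ∑ t, kap t b * (wB' t)⁻¹ ≤ K)
    (X : κ → 𝔸) (s : ℝ) (hX : ∀ t, wB' t * ‖X t‖ ≤ s) (b : ι) :
    w₃ b * ‖T X b‖ ≤ (‖c‖⁻¹ * Mρ * Θ * K) * s := by
  have h1 := norm_adjoint_apply_le_of_kernelEntries τ ρ hρ hτ hτ1 hMρ hρn hc hBE hB 𝔇₀ kap hk0 hΘ hentry hT X b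
  have hs : 0 ≤ s := by
    obtain ⟨t⟩ := ‹Nonempty κ›
    exact le_trans (mul_nonneg (hwB' t).le (norm_nonneg _)) (hX t)
  -- `Σ_t κ(t,b)‖X t‖ ≤ Σ_t κ(t,b)(wB′ t)⁻¹·s`
  have h2 : ∑ t, kap t b * ‖X t‖ ≤ (∑ t, kap t b * (wB' t)⁻¹) * s := by
    rw [Finset.sum_mul]
    refine Finset.sum_le_sum fun t _ => ?_
    have hXt : ‖X t‖ ≤ (wB' t)⁻¹ * s := by
      rw [inv_mul_eq_div, le_div_iff₀ (hwB' t), mul_comm]; exact hX t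
    calc kap t b * ‖X t‖ ≤ kap t b * ((wB' t)⁻¹ * s) := mul_le_mul_of_nonneg_left hXt (hk0 t b)
      _ = kap t b * (wB' t)⁻¹ * s := by ring
  have hcoef : 0 ≤ ‖c‖⁻¹ * Mρ * Θ := by positivity
  calc w₃ b * ‖T X b‖ ≤ w₃ b * (‖c‖⁻¹ * Mρ * Θ * ∑ t, kap t b * ‖X t‖) := mul_le_mul_of_nonneg_left h1 (hw₃ b)
    _ ≤ w₃ b * (‖c‖⁻¹ * Mρ * Θ * ((∑ t, kap t b * (wB' t)⁻¹) * s)) :=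
        mul_le_mul_of_nonneg_left (mul_le_mul_of_nonneg_left h2 hcoef) (hw₃ b)
    _ = ‖c‖⁻¹ * Mρ * Θ * (w₃ b * ∑ t, kap t b * (wB' t)⁻¹) * s := by ring
    _ ≤ ‖c‖⁻¹ * Mρ * Θ * K * s := by
        have := mul_le_mul_of_nonneg_left (hcol b) hcoef
        exact mul_le_mul_of_nonneg_right this hs

end Fibre

/-! ## §2  The capstone ∕ Socket binder `h73t` at the record's (27) pairing, from kernel entries of `fderiv Dfun` and a column sum -/

section Record

variable {P : Params} {𝔸 : Type*} [NormedRing 𝔸] [NormedAlgebra ℂ 𝔸]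

/-- ★★★ **`h73t` FROM (157)-SHAPED KERNEL ENTRIES OF THE CHART's DERIVATIVE AND A WEIGHTED COLUMN SUM** — for every torus `P`, nested family `Dm` (index bonds non-empty),
weights `w` with `w 1, w 3 ≥ 0`, fibre letters (`τ` tracial contractive, dualiser `ρ`, `‖ρℓ‖ ≤ M_ρ‖ℓ‖`), `η ≠ 0`, the (27) pairing `BE = bondPair η d τ` and the block pairing `B`,
ANY chart `Dfun` and ANY `Dt` with `BE (Dt A′ X) δ = B X (fderiv Dfun A′ δ)` (the Socket's existential `Dt`, p606823's formula, …): IF on the two-size ball of radius `ε`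
the entries obey `‖fderiv Dfun A′ (δ_b·a) t‖ ≤ Θ·r·κ(t,b)·‖a‖` for every size bound `r < ε` of `A′` (DISPLAYED — the chart lane's (73)∕(157) per bond), and the column sum
`w₃(b)·Σ_t κ(t,b)∕wB′(t) ≤ K` holds (DISPLAYED — lattice geometry), THEN the binder `h73t` of `K0Stub1SectFWSlotAtRecordSocket.exists_sectF_W_atRecord_of_chartSocket` ∕ p612123
holds VERBATIM with `θ₀ := (|η|^d)⁻¹·M_ρ·Θ·K`. [cite: Balaban1985Variational, (27) p.282, (66) p.287, (72)-(73) p.289, (88)-(90) pp.291-292, Prop. 4 (98) p.293; Balaban1985Averaging, Prop. 5 (157) pp.40-42] -/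
theorem h73t_of_kernelEntries [DecidableEq (PBond P 0)] (k : ℕ) (Dm : Domains P) [Nonempty (BondIdx Dm)]
    (w : ℕ → PBond P 0 → ℝ) (hw1 : ∀ b, 0 ≤ w 1 b) (hw3 : ∀ b, 0 ≤ w 3 b)
    (τ : 𝔸 →L[ℂ] ℂ) (ρ : (𝔸 →L[ℂ] ℂ) →L[ℂ] 𝔸)
    (hρ : ∀ (ℓ' : 𝔸 →L[ℂ] ℂ) (X : 𝔸), τ (ρ ℓ' * X) = ℓ' X) (hτ : ∀ a b : 𝔸, τ (a * b) = τ (b * a)) (hτ1 : ∀ X : 𝔸, ‖τ X‖ ≤ ‖X‖)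
    {Mρ : ℝ} (hMρ : 0 ≤ Mρ) (hρn : ∀ ℓ' : 𝔸 →L[ℂ] ℂ, ‖ρ ℓ'‖ ≤ Mρ * ‖ℓ'‖)
    {η : ℝ} (hη : η ≠ 0)
    (BE : (PBond P 0 → 𝔸) →L[ℂ] (PBond P 0 → 𝔸) →L[ℂ] ℂ)
    (hBE : ∀ Y δ : PBond P 0 → 𝔸, BE Y δ = bondPair η P.d (τ : 𝔸 →ₗ[ℂ] ℂ) (fun μ x => Y ⟨x, μ⟩) (fun μ x => δ ⟨x, μ⟩))
    (B : (BondIdx Dm → 𝔸) →L[ℂ] (BondIdx Dm → 𝔸) →L[ℂ] ℂ) (hB : ∀ X X' : BondIdx Dm → 𝔸, B X X' = ∑ t, τ (X t * X' t))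
    (Dfun : (PBond P 0 → 𝔸) → (BondIdx Dm → 𝔸))
    (Dt : (PBond P 0 → 𝔸) → ((BondIdx Dm → 𝔸) →L[ℂ] (PBond P 0 → 𝔸)))
    (hDt : ∀ (A' : PBond P 0 → 𝔸) X δ, BE (Dt A' X) δ = B X (fderiv ℂ Dfun A' δ))
    {ε : ℝ} (kap : BondIdx Dm → PBond P 0 → ℝ) (hk0 : ∀ t b, 0 ≤ kap t b) {Θ : ℝ} (hΘ : 0 ≤ Θ)
    (hentry : ∀ (A' : PBond P 0 → 𝔸) (r : ℝ), (∀ b, w 1 b * ‖A' b‖ ≤ r) →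
      (∀ (b : PBond P 0) (ν : Fin P.d), w 2 b * (P.L : ℝ) ^ k * ‖A' ⟨b.src.shift ν, b.dir⟩ - A' b‖ ≤ r) → r < ε →
      ∀ (b : PBond P 0) (a : 𝔸) (t : BondIdx Dm), ‖fderiv ℂ Dfun A' (Pi.single b a) t‖ ≤ Θ * r * kap t b * ‖a‖)
    (wB' : BondIdx Dm → ℝ) (hwB' : ∀ t, 0 < wB' t) {K : ℝ} (hcol : ∀ b, w 3 b * ∑ t, kap t b * (wB' t)⁻¹ ≤ K) :
    ∀ (A' : PBond P 0 → 𝔸) (r : ℝ), (∀ b, w 1 b * ‖A' b‖ ≤ r) →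
      (∀ (b : PBond P 0) (ν : Fin P.d), w 2 b * (P.L : ℝ) ^ k * ‖A' ⟨b.src.shift ν, b.dir⟩ - A' b‖ ≤ r) → r < ε →
      ∀ (X : BondIdx Dm → 𝔸) (s : ℝ), (∀ i, wB' i * ‖X i‖ ≤ s) → ∀ b, w 3 b * ‖Dt A' X b‖ ≤ ((|η| ^ P.d)⁻¹ * Mρ * Θ * K) * r * s := by
  intro A' r h0 h1 hr X s hX b
  have hr0 : 0 ≤ r := le_trans (mul_nonneg (hw1 ⟨fun _ => 0, ⟨0, P.hd⟩⟩) (norm_nonneg _)) (h0 _)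
  have hc : ((η : ℂ) ^ P.d) ≠ 0 := pow_ne_zero _ (by exact_mod_cast hη)
  have hBE' : ∀ Y δ : PBond P 0 → 𝔸, BE Y δ = (η : ℂ) ^ P.d * ∑ b, τ (Y b * δ b) := fun Y δ => by
    rw [hBE]; exact bondPair_PBond_eq_sum η (τ : 𝔸 →ₗ[ℂ] ℂ) Y δ
  have hB' : ∀ X X' : BondIdx Dm → 𝔸, B X X' = ∑ t, τ (X t * X' t) := hB
  have h := weighted_column_letter_of_kernelEntries (ι := PBond P 0) (κ := BondIdx Dm) τ ρ hρ hτ hτ1 hMρ hρn hc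
    (BE := fun Y δ => BE Y δ) hBE' (B := fun X X' => B X X') hB'
    ((fderiv ℂ Dfun A' : (PBond P 0 → 𝔸) →L[ℂ] (BondIdx Dm → 𝔸)) : (PBond P 0 → 𝔸) →ₗ[ℂ] (BondIdx Dm → 𝔸))
    kap hk0 (Θ := Θ * r) (mul_nonneg hΘ hr0) (fun b' a t => by
      have := hentry A' r h0 h1 hr b' a t
      simpa only [ContinuousLinearMap.coe_coe] using this)
    (T := fun X => Dt A' X) (fun X δ => hDt A' X δ) (w 3) hw3 wB' hwB' hcol X s hX b
  have hnorm : ‖(η : ℂ) ^ P.d‖ = |η| ^ P.d := by rw [norm_pow, Complex.norm_real, Real.norm_eq_abs]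
  rw [hnorm] at h
  calc w 3 b * ‖Dt A' X b‖ ≤ ((|η| ^ P.d)⁻¹ * Mρ * (Θ * r) * K) * s := h
    _ = ((|η| ^ P.d)⁻¹ * Mρ * Θ * K) * r * s := by ring

end Record

end Summit.QuantumFields.YangMills.Theorems.K0Stub1DtColumnSocket

end
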